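import Summits.CriticalPhenomena.PercolationContinuityZ3.Theorems.Transplant.FKDoubleFanFanExchange
import Summits.CriticalPhenomena.PercolationContinuityZ3.Theorems.Transplant.FKDoubleFanMultifanJunction
import HarnessLib

/-!
# Double fans `K₂ ∨ P_{m+1}`: fan exchange, part 2 — B·A·B middles WITH JUNCTION VERTICES under `HypBA`; in particular every cross-apex pair at
# rim distance three with ARBITRARY weights

Helper file (`--supports stmt-CriticalPhenomena-4575`), FK sub-lane `prim-bschramm-fk-3` (gen 46); builds on p205010 (kernel theorem, internal audit
signed; external expert review pending).  No named facts, no sorries; standard axioms.  Memo `bschramm/prim-bschramm-fk-3/FAR-CROSS-XXI.md` §2.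

`…FanExchange` proves `HypBA ⟹` B·A·B for middles made of a `b`-only run, an `a`-only run and a `b`-only run.  Since the two spokes of ONE rim
vertex commute (`conv_letters_comm`, `midWord_junction` of `…MultifanJunction`), the vertex where the pattern switches may carry BOTH spokes: its
first-acting spoke closes the previous fan and the other one opens the next.  Here: the factorisation of a middle
`mb₁ ++ j₁ :: (ma ++ j₂ :: mb₂)` (runs `b`-only / arbitrary block / `a`-only / arbitrary block / `b`-only) as `fanComboB G₂ ∘ fanCombo F ∘ fanComboB G₁`
(**`midWord_bab_junction`**, **`crossFarZ_bab_junction`**), and (**`negCorr_spokes_cross_far_babj_of_hypBA`**) `HypBA q` ⟹ negative correlation of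
`(a c_j, b c_k)` for every such middle of every weighted double fan (`0 < q ≤ 1`).  With both runs empty (**`negCorr_spokes_cross_three_of_hypBA`**):
under `HypBA`, EVERY cross-apex pair `(a c_j, b c_{j+3})` at rim distance three is negatively correlated, whatever the weights — distances one and two
are unconditional (`negCorr_spokes_cross`, `negCorr_spokes_cross_two`), so `HypBA` (`coneBA ⊆ coneAB`, numerically true, memo §1) is exactly what
separates the kernel from "every pair of edges at rim distance `≤ 3`".
[cite: Grimmett2006, §3.9 eq. (3.94) (pp. 63–64)] [folklore]
-/

noncomputable section

namespace Summit.CriticalPhenomena.PercolationContinuityZ3.Theorems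

namespace FK

namespace ThreeApex

/-! ### The factorisation -/

/-- **B·A·B with TWO JUNCTION vertices** (each may carry both spokes): a `b`-only list `mb₁`, a block `j₁`, an `a`-only list `ma`, a block `j₂`,
a `b`-only list `mb₂` act as `fanComboB G₂ ∘ fanCombo F ∘ fanComboB G₁` with `G₁ = BC_{j₁.y}∗E_{j₁.r}(fanVecB mb₁ fanInit)`,
`F = BC_{j₂.x}∗E_{j₂.r}(fanVec ma (BC_{j₁.x}∗fanInit))`, `G₂ = fanVecB mb₂ (BC_{j₂.y}∗fanInit)` (the two spokes of a junction vertex commute,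
`midWord_junction` of `…MultifanJunction`). [folklore] -/
theorem midWord_bab_junction (q : ℝ) {mb₁ ma mb₂ : List (ℝ × ℝ × ℝ)} (hx1 : ∀ blk ∈ mb₁, blk.2.1 = 0) (hy2 : ∀ blk ∈ ma, blk.2.2 = 0)
    (hx3 : ∀ blk ∈ mb₂, blk.2.1 = 0) (j₁ j₂ : ℝ × ℝ × ℝ) (X : V5) :
    midWord q (mb₁ ++ j₁ :: (ma ++ j₂ :: mb₂)) X =
      fanComboB q (fanVecB q mb₂ (conv (edgeBC j₂.2.2) fanInit))
        (fanCombo q (conv (edgeBC j₂.2.1) (rimStep q j₂.1 (fanVec q ma (conv (edgeBC j₁.2.1) fanInit))))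
          (fanComboB q (conv (edgeBC j₁.2.2) (rimStep q j₁.1 (fanVecB q mb₁ fanInit))) X)) := by
  have e₁ : j₁ :: (ma ++ j₂ :: mb₂) = [j₁] ++ (ma ++ ([j₂] ++ mb₂)) := rfl
  rw [midWord_appendList, midWord_oneSidedB_init q hx1, e₁, midWord_appendList, midWord_appendList, midWord_appendList]
  -- the first junction block on `fanComboB G₁⁰ X`
  have hj₁ : midWord q [j₁] (fanComboB q (fanVecB q mb₁ fanInit) X) =
      fanCombo q (conv (edgeBC j₁.2.1) fanInit) (fanComboB q (conv (edgeBC j₁.2.2) (rimStep q j₁.1 (fanVecB q mb₁ fanInit))) X) := by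
    simp only [midWord, rimStep_fanComboB, conv_edgeBC_fanComboB]
    rw [← conv_edgeAC_fanCombo, fanCombo_init]
  rw [hj₁, midWord_oneSided q hy2, midWord_junction, midWord_oneSidedB q hx3]

/-- **`crossFarZ` of a B·A·B middle with two junction vertices**, as a pairing `val((G₂ʳᵉᵛ(s∗BC_τ)) ∗ X_σ)` with
`X_σ = fanCombo F (fanComboB G₁ (AC_σ∗u))` and `G₂ = E_{rd}(fanVecB mb₂ (BC_{j₂.y}∗fanInit))`. [folklore] -/
theorem crossFarZ_bab_junction (q : ℝ) {mb₁ ma mb₂ : List (ℝ × ℝ × ℝ)} (hx1 : ∀ blk ∈ mb₁, blk.2.1 = 0) (hy2 : ∀ blk ∈ ma, blk.2.2 = 0)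
    (hx3 : ∀ blk ∈ mb₂, blk.2.1 = 0) (j₁ j₂ : ℝ × ℝ × ℝ) (rd : ℝ) (u s : V5) (σ τ : ℝ) :
    crossFarZ q (mb₁ ++ j₁ :: (ma ++ j₂ :: mb₂)) rd u s σ τ =
      val q (conv (fanComboBrev q (rimStep q rd (fanVecB q mb₂ (conv (edgeBC j₂.2.2) fanInit))) (conv s (edgeBC τ)))
        (fanCombo q (conv (edgeBC j₂.2.1) (rimStep q j₂.1 (fanVec q ma (conv (edgeBC j₁.2.1) fanInit))))
          (fanComboB q (conv (edgeBC j₁.2.2) (rimStep q j₁.1 (fanVecB q mb₁ fanInit))) (conv (edgeAC σ) u)))) := by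
  simp only [crossFarZ]
  rw [midWord_bab_junction q hx1 hy2 hx3, rimStep_fanComboB, conv_conv_edgeBC_assoc, val_conv_fanComboB]

/-- `fanVecB mb (BC_y ∗ fanInit) = fanVecB ((1, 0, y) :: mb) fanInit` — the junction `b`-spoke as a genuine first block (rim weight `1`). [folklore] -/
theorem fanVecB_cons_one (q : ℝ) (mb : List (ℝ × ℝ × ℝ)) (y : ℝ) :
    fanVecB q mb (conv (edgeBC y) fanInit) = fanVecB q (((1 : ℝ), (0 : ℝ), y) :: mb) fanInit := by
  simp only [fanVecB, rimStep_one]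

/-- Unit weights of the extended `b`-only block list. [folklore] -/
theorem unitBlocks_cons_one {mb : List (ℝ × ℝ × ℝ)} (hmb : UnitBlocks mb) {y : ℝ} (hy0 : 0 ≤ y) (hy1 : y ≤ 1) :
    UnitBlocks ((((1 : ℝ), (0 : ℝ), y) :: mb)) := by
  intro blk hblk
  rcases List.mem_cons.1 hblk with rfl | h
  · exact ⟨zero_le_one, le_rfl, le_rfl, zero_le_one, hy0, hy1⟩
  · exact hmb blk h

/-- The extended list is still `b`-only. [folklore] -/
theorem bOnly_cons_one {mb : List (ℝ × ℝ × ℝ)} (hb : ∀ blk ∈ mb, blk.2.1 = 0) (y : ℝ) :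
    ∀ blk ∈ ((((1 : ℝ), (0 : ℝ), y) :: mb)), blk.2.1 = 0 := by
  intro blk hblk
  rcases List.mem_cons.1 hblk with rfl | h
  · rfl
  · exact hb blk h


open MeasureTheory Literature.Probability.LatticeModels Literature.Probability.Percolation
open scoped Classical

variable {V : Type*} [Fintype V]

section Setting

variable {a b : V} {c : ℕ → V} {m : ℕ}
variable (hab : a ≠ b) (hinj : ∀ j k, j ≤ m → k ≤ m → c j = c k → j = k) (hca : ∀ j, j ≤ m → c j ≠ a) (hcb : ∀ j, j ≤ m → c j ≠ b)
include hab hinj hca hcb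

/-- **`HypBA` ALONE ⟹ B·A·B WITH JUNCTION VERTICES** (`0 < q ≤ 1`): for every weighted double fan (`card V = m + 3`, weights supported on the
double-fan pairs) and all `j ≤ ℓ₁`, `ℓ₁ + 1 ≤ ℓ₂`, `ℓ₂ + 2 ≤ k ≤ m` with `w(a c_i) = 0` for `j < i ≤ ℓ₁`, `w(b c_i) = 0` for `ℓ₁ + 1 < i ≤ ℓ₂` and
`w(a c_i) = 0` for `ℓ₂ + 1 < i < k` — NO condition at the two junction vertices `c_{ℓ₁+1}`, `c_{ℓ₂+1}` — the pair `(a c_j, b c_k)` is negatively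
correlated. [folklore] -/
theorem negCorr_spokes_cross_far_babj_of_hypBA (hcard : Fintype.card V = m + 3) {q : ℝ} (hq0 : 0 < q) (hq1 : q ≤ 1)
    (w : Sym2 V → unitInterval) (hsupp : ∀ e, e ∉ dfPairs a b c m → w e = 0) (hBA : HypBA q)
    {j ℓ₁ ℓ₂ k : ℕ} (hj1 : j ≤ ℓ₁) (h12 : ℓ₁ + 1 ≤ ℓ₂) (h2k : ℓ₂ + 2 ≤ k) (hk : k ≤ m)
    (ha1 : ∀ i, j < i → i ≤ ℓ₁ → w s(a, c i) = 0) (hb2 : ∀ i, ℓ₁ + 1 < i → i ≤ ℓ₂ → w s(b, c i) = 0)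
    (ha3 : ∀ i, ℓ₂ + 1 < i → i < k → w s(a, c i) = 0) :
    (rcMeasureW w q ∅).real ({ω : BondConfig V | s(a, c j) ∈ ω} ∩ {ω | s(b, c k) ∈ ω}) ≤
      (rcMeasureW w q ∅).real {ω : BondConfig V | s(a, c j) ∈ ω} * (rcMeasureW w q ∅).real {ω : BondConfig V | s(b, c k) ∈ ω} := by
  obtain ⟨d, rfl⟩ : ∃ d, k = j + d + 1 := ⟨k - j - 1, by omega⟩
  refine negCorr_spokes_cross_far_of_rayleigh hab hinj hca hcb hcard hq0 w hsupp hk ?_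
  have huK : InKE q (conv (edgeBC (wR w s(b, c j))) (blockIn q w a b c j)) :=
    InKE.step (IsLetter.bc (w _).2.1 (w _).2.2) (inKE_blockIn q w a b c j)
  have hsK : InKE q (conv (restVec q w a b c (j + d + 1) (m - (j + d + 1))) (edgeAC (wR w s(a, c (j + d + 1))))) :=
    InKE.mul (inKE_restVec q w a b c (m - (j + d + 1)) (j + d + 1)) (by
      rw [← mul_one (edgeAC (wR w s(a, c (j + d + 1)))), mul_def, one_def]
      exact InKE.step (IsLetter.ac (w _).2.1 (w _).2.2) InKE.base)
  -- split: `b`-run `n₁`, junction `c_{ℓ₁+1}`, `a`-run `n₂`, junction `c_{ℓ₂+1}`, `b`-run `n₃`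
  set n₁ := ℓ₁ - j with hn₁
  set n₂ := ℓ₂ - ℓ₁ - 1 with hn₂
  obtain ⟨n₃, hn₃⟩ : ∃ n₃, d = n₁ + (1 + (n₂ + (1 + n₃))) := ⟨d - n₁ - n₂ - 2, by omega⟩
  set i₁ := j + n₁ with hi₁
  set i₂ := j + n₁ + 1 + n₂ with hi₂
  set j₁ : ℝ × ℝ × ℝ := (wR w s(c i₁, c (i₁ + 1)), wR w s(a, c (i₁ + 1)), wR w s(b, c (i₁ + 1))) with hj₁
  set j₂ : ℝ × ℝ × ℝ := (wR w s(c i₂, c (i₂ + 1)), wR w s(a, c (i₂ + 1)), wR w s(b, c (i₂ + 1))) with hj₂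
  have hsplit : midBlocks w a b c j d =
      midBlocks w a b c j n₁ ++ j₁ :: (midBlocks w a b c (j + n₁ + 1) n₂ ++ j₂ :: midBlocks w a b c (j + n₁ + 1 + n₂ + 1) n₃) := by
    rw [hn₃, midBlocks_split w a b c j n₁, midBlocks_split w a b c (j + n₁) 1, midBlocks_one, List.singleton_append,
      midBlocks_split w a b c (j + n₁ + 1) n₂, midBlocks_split w a b c (j + n₁ + 1 + n₂) 1, midBlocks_one, List.singleton_append]
  have hx1 : ∀ blk ∈ midBlocks w a b c j n₁, blk.2.1 = 0 :=
    midBlocks_aSpoke_zero w a b c j n₁ (fun i hi hi' => ha1 i hi (by omega))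
  have hy2 : ∀ blk ∈ midBlocks w a b c (j + n₁ + 1) n₂, blk.2.2 = 0 :=
    midBlocks_bSpoke_zero w a b c (j + n₁ + 1) n₂ (fun i hi hi' => hb2 i (by omega) (by omega))
  have hx3 : ∀ blk ∈ midBlocks w a b c (j + n₁ + 1 + n₂ + 1) n₃, blk.2.1 = 0 :=
    midBlocks_aSpoke_zero w a b c (j + n₁ + 1 + n₂ + 1) n₃ (fun i hi hi' => ha3 i (by omega) (by omega))
  set mb₁ := midBlocks w a b c j n₁
  set ma := midBlocks w a b c (j + n₁ + 1) n₂
  set mb₂ := midBlocks w a b c (j + n₁ + 1 + n₂ + 1) n₃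
  set rd := wR w s(c (j + d), c (j + d + 1))
  set u := conv (edgeBC (wR w s(b, c j))) (blockIn q w a b c j)
  set s := conv (restVec q w a b c (j + d + 1) (m - (j + d + 1))) (edgeAC (wR w s(a, c (j + d + 1))))
  have hrd0 : 0 ≤ rd := (w _).2.1
  have hrd1 : rd ≤ 1 := (w _).2.2
  set F := conv (edgeBC j₂.2.1) (rimStep q j₂.1 (fanVec q ma (conv (edgeBC j₁.2.1) fanInit)))
  set G₁ := conv (edgeBC j₁.2.2) (rimStep q j₁.1 (fanVecB q mb₁ fanInit))
  have hF : InKE q F :=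
    InKE.step (IsLetter.bc (w _).2.1 (w _).2.2) (InKE.rim (w _).2.1 (w _).2.2
      (fanVec_inKE (unitBlocks_midBlocks w a b c (j + n₁ + 1) n₂) (InKE.step (IsLetter.bc (w _).2.1 (w _).2.2) (fanInit_inKE q))))
  have hG₁ : InKE q G₁ :=
    InKE.step (IsLetter.bc (w _).2.1 (w _).2.2) (InKE.rim (w _).2.1 (w _).2.2
      (fanVecB_inKE (unitBlocks_midBlocks w a b c j n₁) (fanInit_inKE q)))
  set X : ℝ → V5 := fun σ => fanCombo q F (fanComboB q G₁ (conv (edgeAC σ) u))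
  set Y : ℝ → V5 := fun τ => fanComboBrev q (rimStep q rd (fanVecB q (((1 : ℝ), (0 : ℝ), j₂.2.2) :: mb₂) fanInit)) (conv s (edgeBC τ))
  have hZ : ∀ σ τ : ℝ, crossFarZ q (midBlocks w a b c j d) rd u s σ τ = val q (conv (Y τ) (X σ)) := by
    intro σ τ; rw [hsplit, crossFarZ_bab_junction q hx1 hy2 hx3, fanVecB_cons_one]
  have hmem : wedgeH (X 0) (X 1) ∈ coneAB q := hBA F G₁ u hF hG₁ huK
  have hdual : DualAB q (wedgeH (Y 0) (Y 1)) :=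
    dualAB_bTarget hq0 hq1 (unitBlocks_cons_one (unitBlocks_midBlocks w a b c (j + n₁ + 1 + n₂ + 1) n₃) (w _).2.1 (w _).2.2)
      (bOnly_cons_one hx3 _) hrd0 hrd1 hsK
  have hpos : ∀ β, β ∈ coneAB q → 0 ≤ pairH q β (wedgeH (Y 0) (Y 1)) := fun β hβ => hβ _ hdual
  have key := rayleigh_of_isOpCone hmem hpos
  have e : ∀ A B : V5, conv A B = conv B A := fun A B => by simp only [← mul_def]; ac_rfl
  simp only
  rw [hZ, hZ, hZ, hZ, e (Y 1) (X 1), e (Y 0) (X 0), e (Y 0) (X 1), e (Y 1) (X 0)]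
  linarith [key]

/-- **`HypBA ⟹` EVERY CROSS-APEX PAIR AT RIM DISTANCE THREE, ARBITRARY WEIGHTS** (`0 < q ≤ 1`): the two middle vertices `c_{j+1}, c_{j+2}` are the
two junctions of an (empty-run) B·A·B middle. [folklore] -/
theorem negCorr_spokes_cross_three_of_hypBA (hcard : Fintype.card V = m + 3) {q : ℝ} (hq0 : 0 < q) (hq1 : q ≤ 1)
    (w : Sym2 V → unitInterval) (hsupp : ∀ e, e ∉ dfPairs a b c m → w e = 0) (hBA : HypBA q) {j : ℕ} (hj : j + 3 ≤ m) :
    (rcMeasureW w q ∅).real ({ω : BondConfig V | s(a, c j) ∈ ω} ∩ {ω | s(b, c (j + 3)) ∈ ω}) ≤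
      (rcMeasureW w q ∅).real {ω : BondConfig V | s(a, c j) ∈ ω} * (rcMeasureW w q ∅).real {ω : BondConfig V | s(b, c (j + 3)) ∈ ω} :=
  negCorr_spokes_cross_far_babj_of_hypBA hab hinj hca hcb hcard hq0 hq1 w hsupp hBA (ℓ₁ := j) (ℓ₂ := j + 1) le_rfl le_rfl (by omega) hj
    (fun i hi hi' => absurd hi' (by omega)) (fun i hi hi' => absurd hi' (by omega)) (fun i hi hi' => absurd hi' (by omega))

end Setting

end ThreeApex

end FK

end Summit.CriticalPhenomena.PercolationContinuityZ3.Theorems
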